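import Summits.ResolutionOfSingularities.ResolutionOfSingularities.Theorems.FrobeniusLadderFRationalResolutionHomogeneousUnits
import Mathlib.RingTheory.GradedAlgebra.Homogeneous.Ideal
import Mathlib.RingTheory.Ideal.Quotient.Operations
import Mathlib.RingTheory.Flat.Basic
import HarnessLib

/-!
# Crux `FrobeniusLadder.FRationalResolution` (stmt-ResolutionOfSingularities-15317), line `redirect`,
# stub `stub_diagonalizableQuotientResolution` — the quotient of a graded algebra by a homogeneous
# ideal swallowing the unit-free degrees is FREE over the degree-zero quotient (step (e3) of the
# Kato-(7.1)-at-fixed-points plan, memo MEMO-15317-leafhand2-g3 §6)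

The stratum ring of the plan is `T = S_{gh}/(x_I)` for the graded localization `S_{gh}` of the chart
ring near a prime `𝔔'` over a neighbour `𝔮'` of the fixed point: there the surviving parameters
`x_j`, `j ∉ I`, are UNITS, so every degree in the subgroup they generate carries a unit monomial,
while every other degree is spanned by monomials touching `I` (`…FixedPointMonomialNhd`,
`…FixedPointContraction`), i.e. lies in `(x_I)`. This file isolates the abstract statement, with NO
grading constructed on the quotient: for a graded algebra `S = ⊕_c S_c`, a HOMOGENEOUS ideal `I`, and
a set of degrees `D` such that every `c ∈ D` carries a homogeneous unit `u_c` and `S_c ⊆ I` for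
`c ∉ D`, the quotient `S/I` is FREE over `S₀/(I ∩ S₀)` on the classes of the `u_c`:

* `exists_basis_quotient` — the basis; `free_quotient`, `flat_quotient` — hence free and flat (so
  regularity descends from `S/I` to `S₀/(I ∩ S₀)` prime by prime, `…FlatPrimeDescent`). The
  degree-zero ring is an abstract `R₀ → S` onto `S₀` (instantiate `R₀ = ↥(𝒮 0)` or a localized
  degree-zero piece), to keep quotient instances diamond-free.

Honest label: generic brick (no stub closed). No definitions, no named facts, no sorry.
[folklore; cite: SGA3, Exp. VIII §4–5] [cite: BrunsHerzog1998, §1.5]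
-/

noncomputable section

-- single-problem summit: the doubled namespace component is forced
set_option linter.dupNamespace false

open DirectSum

namespace Summit.ResolutionOfSingularities.ResolutionOfSingularities.Theorems.FRationalResolution.GradedQuotientFree

universe u v w

variable {k : Type u} [CommRing k] {A : Type w} [DecidableEq A] [AddCommGroup A] {S : Type v}
  [CommRing S] [Algebra k S] (𝒮 : A → Submodule k S) [GradedAlgebra 𝒮]
  {R₀ : Type u} [CommRing R₀] [Algebra R₀ S]

/-- **Free quotient over the degree-zero quotient.** `S` graded, `R₀ → S` a ring ONTO the degree-zero
part `S₀` (kept abstract to avoid instance diamonds on `↥(𝒮 0)`; take `R₀ = S₀`), `I` a homogeneous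
ideal, `J = I ∩ R₀`; `D` a set of degrees with homogeneous units `u_c ∈ S_c` (`c ∈ D`) and `S_c ⊆ I`
(`c ∉ D`). Then the classes `ū_c`, `c ∈ D`, form an `R₀/J`-basis of `S/I`.
[folklore; cite: SGA3, Exp. VIII §4–5] -/
theorem exists_basis_quotient (h0 : ∀ r : R₀, algebraMap R₀ S r ∈ 𝒮 0)
    (hsurj : ∀ s ∈ 𝒮 0, ∃ r : R₀, algebraMap R₀ S r = s)
    (I : Ideal S) (hI : I.IsHomogeneous 𝒮) (D : Set A) (u : A → S)
    (hu : ∀ c ∈ D, u c ∈ 𝒮 c) (hunit : ∀ c ∈ D, IsUnit (u c))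
    (hzero : ∀ c ∉ D, (𝒮 c : Set S) ⊆ I) :
    ∃ basis : Module.Basis D (R₀ ⧸ I.comap (algebraMap R₀ S)) (S ⧸ I),
      ∀ c : D, basis c = Ideal.Quotient.mk I (u c) := by
  classical
  set J : Ideal R₀ := I.comap (algebraMap R₀ S) with hJ
  have hinv : ∀ c : D, ∃ v : S, u c * v = 1 := fun c => (hunit c c.2).exists_right_inv
  choose v hv using hinv
  -- the scalar action of `R₀/J` on `S/I`
  have hsmul : ∀ (r : R₀) (y : S), (Ideal.Quotient.mk J r) • (Ideal.Quotient.mk I y) =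
      Ideal.Quotient.mk I (algebraMap R₀ S r * y) := fun r y => by
    rw [Algebra.smul_def, map_mul]
    rfl
  -- linear independence
  have hli : LinearIndependent (R₀ ⧸ J) (fun c : D => Ideal.Quotient.mk I (u c)) := by
    rw [linearIndependent_iff']
    intro s r hsum c hc
    -- lift the coefficients
    choose r' hr' using fun d : D => Ideal.Quotient.mk_surjective (r d)
    have hsum' : Ideal.Quotient.mk I (∑ d ∈ s, algebraMap R₀ S (r' d) * u d) = 0 := by
      rw [map_sum, ← hsum]
      refine Finset.sum_congr rfl fun d _ => ?_
      rw [← hsmul, hr']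
    rw [Ideal.Quotient.eq_zero_iff_mem] at hsum'
    -- the degree-`c` component of the sum is `r'_c u_c`, and lies in `I`
    have hcomp : ∀ d ∈ s, (decompose 𝒮 (algebraMap R₀ S (r' d) * u d) (c : A) : S) =
        if d = c then algebraMap R₀ S (r' c) * u c else 0 := by
      intro d _
      have hmem : algebraMap R₀ S (r' d) * u d ∈ 𝒮 (d : A) := by
        have h := SetLike.mul_mem_graded (h0 (r' d)) (hu d d.2)
        rwa [zero_add] at h
      by_cases hdc : d = c
      · subst hdc
        rw [if_pos rfl, decompose_of_mem_same 𝒮 hmem]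
      · rw [if_neg hdc, decompose_of_mem_ne 𝒮 hmem (fun h => hdc (Subtype.ext h))]
    have hproj : (decompose 𝒮 (∑ d ∈ s, algebraMap R₀ S (r' d) * u d) (c : A) : S) =
        algebraMap R₀ S (r' c) * u c := by
      have h : GradedRing.proj 𝒮 (c : A) (∑ d ∈ s, algebraMap R₀ S (r' d) * u d) =
          ∑ d ∈ s, (decompose 𝒮 (algebraMap R₀ S (r' d) * u d) (c : A) : S) := by
        rw [map_sum]
        simp only [GradedRing.proj_apply]
      rw [GradedRing.proj_apply] at h
      rw [h, Finset.sum_congr rfl hcomp, Finset.sum_ite_eq' s c, if_pos hc]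
    have hcI : algebraMap R₀ S (r' c) * u c ∈ I := by
      rw [← hproj]
      exact (hI.mem_iff.mp hsum') (c : A)
    have hrI : algebraMap R₀ S (r' c) ∈ I := by
      have h := I.mul_mem_right (v c) hcI
      rwa [mul_assoc, hv c, mul_one] at h
    rw [← hr' c]
    exact Ideal.Quotient.eq_zero_iff_mem.mpr (Ideal.mem_comap.mpr hrI)
  -- spanning
  have hsp : ⊤ ≤ Submodule.span (R₀ ⧸ J) (Set.range fun c : D => Ideal.Quotient.mk I (u c)) := by
    rintro y -
    obtain ⟨t, rfl⟩ := Ideal.Quotient.mk_surjective y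
    rw [← sum_support_decompose 𝒮 t, map_sum]
    refine Submodule.sum_mem _ fun b _ => ?_
    by_cases hbD : b ∈ D
    · obtain ⟨r, hr, hrb⟩ :=
        (HomogeneousUnits.mem_grade_iff_exists_mul_unit 𝒮 (hu b hbD) (hv ⟨b, hbD⟩) _).mp
          (decompose 𝒮 t b).2
      obtain ⟨r₀, hr₀⟩ := hsurj r hr
      rw [hrb, ← hr₀, ← hsmul r₀ (u b)]
      exact Submodule.smul_mem _ _ (Submodule.subset_span ⟨⟨b, hbD⟩, rfl⟩)
    · have hz : Ideal.Quotient.mk I (decompose 𝒮 t b : S) = 0 :=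
        Ideal.Quotient.eq_zero_iff_mem.mpr (hzero b hbD (decompose 𝒮 t b).2)
      rw [hz]
      exact Submodule.zero_mem _
  exact ⟨Module.Basis.mk hli hsp, fun c => Module.Basis.mk_apply hli hsp c⟩

/-- Hence `S/I` is FREE over `R₀/(I ∩ R₀)`. [folklore; cite: SGA3, Exp. VIII §4–5] -/
theorem free_quotient (h0 : ∀ r : R₀, algebraMap R₀ S r ∈ 𝒮 0)
    (hsurj : ∀ s ∈ 𝒮 0, ∃ r : R₀, algebraMap R₀ S r = s)
    (I : Ideal S) (hI : I.IsHomogeneous 𝒮) (D : Set A) (u : A → S)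
    (hu : ∀ c ∈ D, u c ∈ 𝒮 c) (hunit : ∀ c ∈ D, IsUnit (u c))
    (hzero : ∀ c ∉ D, (𝒮 c : Set S) ⊆ I) :
    Module.Free (R₀ ⧸ I.comap (algebraMap R₀ S)) (S ⧸ I) := by
  obtain ⟨basis, -⟩ := exists_basis_quotient 𝒮 h0 hsurj I hI D u hu hunit hzero
  exact Module.Free.of_basis basis

/-- Hence `S/I` is FLAT over `R₀/(I ∩ R₀)`. [folklore; cite: SGA3, Exp. VIII §4–5] -/
theorem flat_quotient (h0 : ∀ r : R₀, algebraMap R₀ S r ∈ 𝒮 0)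
    (hsurj : ∀ s ∈ 𝒮 0, ∃ r : R₀, algebraMap R₀ S r = s)
    (I : Ideal S) (hI : I.IsHomogeneous 𝒮) (D : Set A) (u : A → S)
    (hu : ∀ c ∈ D, u c ∈ 𝒮 c) (hunit : ∀ c ∈ D, IsUnit (u c))
    (hzero : ∀ c ∉ D, (𝒮 c : Set S) ⊆ I) :
    Module.Flat (R₀ ⧸ I.comap (algebraMap R₀ S)) (S ⧸ I) := by
  haveI := free_quotient 𝒮 h0 hsurj I hI D u hu hunit hzero
  infer_instance

end Summit.ResolutionOfSingularities.ResolutionOfSingularities.Theorems.FRationalResolution.GradedQuotientFree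

end
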